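import Literature.Barriers.AtomisticToContinuum.NoBVEstimatesMultiDFamilySmallness
import HarnessLib

/-!
# The family `W_δ`: sup-Cauchy smallness of the spatial derivative of `∂ₜW_δ`

Brick B-ε, §2e, of the Kato existence programme for the symmetrizable branch of Rauch's Local
Existence Theorem (towards `Rauch1986_smallAmplitudeExpansionL2`). To prove that the limit of the
regularised solutions is jointly `C²` one needs, besides the convergence of `W_δ, ∂W_δ, ∂²W_δ` and
of `∂ₜW_δ = -ρ_δ⋆ρ_δ⋆G(W_δ)` (`NoBVEstimatesMultiDFamilySmallness.lean`), the convergence of the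
spatial derivative `∂ᵢ∂ₜW_δ = -∂ᵢ(ρ_δ⋆ρ_δ⋆G(W_δ))` [TaylorPDEIII2011, Ch. 16, §1, (1.22)]. This file
supplies it:

* `exists_norm_fderiv_sub_le_of_bdd` — `DF` is Lipschitz for a smooth `F` with globally bounded
  derivatives (tested against vectors: no third-order operator norms);
* `cwd_singleton_gfield_eq` — `∂ᵢG(w) = Σⱼ (aⱼ(w)∂ᵢ∂ⱼw + (Daⱼ(w)∂ᵢw)∂ⱼw) + Db(w)∂ᵢw`;
* `norm_cwd_singleton_gfield_sub_le` — the pointwise Lipschitz bound of `∂ᵢG` in the 2-jet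
  `(w, ∂w, ∂²w)`;
* `exists_sup_small_dxdtWfam` — **sup-Cauchy smallness of `∂ᵢ(ρ_δ⋆ρ_δ⋆G(W_δ(t)))`** as
  `δ, δ' → 0`, uniformly on `[-T, T] × ℝᵈ` under the smallness condition on the datum.

Everything is proved; no named fact and no `sorry` is introduced.

## References

* [TaylorPDEIII2011] M. E. Taylor, *Partial Differential Equations III*, 2nd ed. (2011), Ch. 16,
  §1, (1.20)–(1.22).
* [Majda1984] A. Majda, *Compressible Fluid Flow and Systems of Conservation Laws in Several
  Space Variables* (1984), Ch. 2, §2.1, Thm 2.1 (proof, Step 3).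
-/

noncomputable section

open MeasureTheory Set Function Filter Metric ContinuousLinearMap
open scoped ContDiff Topology ENNReal NNReal Convolution RealInnerProductSpace

namespace Literature.Barriers.AtomisticToContinuum

open Literature.Analysis.PDE Literature.Analysis.FunctionSpaces Literature.Analysis.ODE

variable {d k : ℕ}

/-! ### `DF` is Lipschitz for `F` with bounded derivatives -/

/-- **`‖DF(y) - DF(y')‖ ≤ K₂ ‖y - y'‖`** for a smooth `F` all of whose derivatives are globally
bounded (mean value inequality for `z ↦ DF(z)v`, `norm_iteratedFDeriv_clm_apply_const`).
[folklore] -/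
theorem exists_norm_fderiv_sub_le_of_bdd {V G : Type*} [NormedAddCommGroup V] [NormedSpace ℝ V]
    [NormedAddCommGroup G] [NormedSpace ℝ G] {F : V → G} (hF : ContDiff ℝ ∞ F)
    (hK : ∀ i : ℕ, ∃ K : ℝ, ∀ y, ‖iteratedFDeriv ℝ i F y‖ ≤ K) :
    ∃ K : ℝ, 0 ≤ K ∧ ∀ y y', ‖fderiv ℝ F y - fderiv ℝ F y'‖ ≤ K * ‖y - y'‖ := by
  obtain ⟨K, hK2⟩ := hK 2
  have hK' : ∀ y, ‖iteratedFDeriv ℝ 2 F y‖ ≤ max K 0 := fun y => (hK2 y).trans (le_max_left _ _)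
  have hF1 : ContDiff ℝ ∞ (fderiv ℝ F) := hF.fderiv_right (m := ∞) (by norm_cast)
  refine ⟨max K 0, le_max_right _ _, fun y y' => ?_⟩
  refine opNorm_le_bound _ (by positivity) fun v => ?_
  set g : V → G := fun z => fderiv ℝ F z v with hg
  have hgs : ContDiff ℝ ∞ g := hF1.clm_apply contDiff_const
  have hgd : Differentiable ℝ g := hgs.differentiable (by simp)
  have hgb : ∀ z, ‖fderiv ℝ g z‖ ≤ max K 0 * ‖v‖ := fun z => by
    rw [← norm_iteratedFDeriv_one]
    calc ‖iteratedFDeriv ℝ 1 g z‖ ≤ ‖v‖ * ‖iteratedFDeriv ℝ 1 (fderiv ℝ F) z‖ :=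
          norm_iteratedFDeriv_clm_apply_const hF1.contDiffAt (by exact_mod_cast le_top)
      _ = ‖v‖ * ‖iteratedFDeriv ℝ 2 F z‖ := by rw [norm_iteratedFDeriv_fderiv]
      _ ≤ ‖v‖ * max K 0 := mul_le_mul_of_nonneg_left (hK' z) (norm_nonneg _)
      _ = max K 0 * ‖v‖ := mul_comm _ _
  have hmv := (convex_univ).norm_image_sub_le_of_norm_fderiv_le (fun z _ => hgd z)
    (fun z _ => hgb z) (mem_univ y') (mem_univ y)
  calc ‖(fderiv ℝ F y - fderiv ℝ F y') v‖ = ‖g y - g y'‖ := by simp [hg]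
    _ ≤ max K 0 * ‖v‖ * ‖y - y'‖ := hmv
    _ = max K 0 * ‖y - y'‖ * ‖v‖ := by ring

/-! ### `∂ᵢG(w)` through the 2-jet of `w` -/

variable {M L : ℝ} {a : Fin d → EuclideanSpace ℝ (Fin k) → (EuclideanSpace ℝ (Fin k) →L[ℝ] EuclideanSpace ℝ (Fin k))}
  {b : EuclideanSpace ℝ (Fin k) → EuclideanSpace ℝ (Fin k)}
  {s : EuclideanSpace ℝ (Fin k) → (EuclideanSpace ℝ (Fin k) →L[ℝ] EuclideanSpace ℝ (Fin k))}

/-- **`∂ᵢG(w)(x) = Σⱼ (aⱼ(w x) ∂ᵢ∂ⱼw(x) + (Daⱼ(w x)(∂ᵢw x)) ∂ⱼw(x)) + Db(w x)(∂ᵢw x)`.**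
[cite: Majda1984, Ch. 2 §2.1] -/
theorem cwd_singleton_gfield_eq (hS : IsSymmSmoothCoeff M L a b s)
    {w : EuclideanSpace ℝ (Fin d) → EuclideanSpace ℝ (Fin k)} (hw : ContDiff ℝ ∞ w) (i : Fin d)
    (x : EuclideanSpace ℝ (Fin d)) :
    cwd [i] (gfield a b w) x =
      (∑ j, (a j (w x) (cwd [i, j] w x) + fderiv ℝ (a j) (w x) (cwd [i] w x) (cwd [j] w x))) +
        fderiv ℝ b (w x) (cwd [i] w x) := by
  rw [cwd_gfield_eq hS hw [i]]
  have hca : ∀ j : Fin d, cwd [i] (fun y => a j (w y)) x = fderiv ℝ (a j) (w x) (cwd [i] w x) := fun j =>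
    congrFun (fderiv_comp_apply_bv_eq (hS.smooth_a j) hw i) x
  have hcb : cwd [i] (fun y => b (w y)) x = fderiv ℝ b (w x) (cwd [i] w x) :=
    congrFun (fderiv_comp_apply_bv_eq hS.smooth_b hw i) x
  have hij : ∀ j : Fin d, cwd [i] (cwd [j] w) x = cwd [i, j] w x := fun j => by rw [← cwd_append]; rfl
  simp only [splittings, List.flatMap_cons, List.flatMap_nil, List.map_cons, List.map_nil,
    List.sum_cons, List.sum_nil, add_zero, ContinuousLinearMap.id_apply, cwd_nil, hca, hcb, hij,
    List.append_nil]

/-- **Pointwise Lipschitz bound of `∂ᵢG` in the 2-jet.** With `‖aⱼ‖, ‖Daⱼ‖ ≤ M`,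
`‖Daⱼ(p) - Daⱼ(p')‖ ≤ Kₐ‖p - p'‖`, `‖Db‖ ≤ L`, `‖Db(p) - Db(p')‖ ≤ K_b‖p - p'‖`, and all first
and `(i, ·)`-second word derivatives of `w₁, w₂` bounded by `R`:
`‖∂ᵢG(w₁)(x) - ∂ᵢG(w₂)(x)‖ ≤ C · Δ(x)`,
`Δ(x) = ‖w₁ x - w₂ x‖ + Σⱼ‖∂ⱼw₁ x - ∂ⱼw₂ x‖ + Σⱼ‖∂ᵢ∂ⱼw₁ x - ∂ᵢ∂ⱼw₂ x‖`.
[cite: Majda1984, Ch. 2 §2.1] -/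
theorem norm_cwd_singleton_gfield_sub_le (hS : IsSymmSmoothCoeff M L a b s)
    {w₁ w₂ : EuclideanSpace ℝ (Fin d) → EuclideanSpace ℝ (Fin k)} (hw₁ : ContDiff ℝ ∞ w₁)
    (hw₂ : ContDiff ℝ ∞ w₂) {R Ka Kb : ℝ} (hR : 0 ≤ R) (hKa : 0 ≤ Ka) (hKb : 0 ≤ Kb)
    (hKa' : ∀ j p p', ‖fderiv ℝ (a j) p - fderiv ℝ (a j) p'‖ ≤ Ka * ‖p - p'‖)
    (hKb' : ∀ p p', ‖fderiv ℝ b p - fderiv ℝ b p'‖ ≤ Kb * ‖p - p'‖)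
    (i : Fin d) (x : EuclideanSpace ℝ (Fin d))
    (h1₁ : ∀ j, ‖cwd [j] w₁ x‖ ≤ R) (h1₂ : ∀ j, ‖cwd [j] w₂ x‖ ≤ R)
    (h2₂ : ∀ j, ‖cwd [i, j] w₂ x‖ ≤ R) :
    ‖cwd [i] (gfield a b w₁) x - cwd [i] (gfield a b w₂) x‖ ≤
      (d * (M * R + Ka * R ^ 2) + Kb * R + (d * M * R + L) + M * R + M) *
        (‖w₁ x - w₂ x‖ + ∑ j, ‖cwd [j] w₁ x - cwd [j] w₂ x‖ +
          ∑ j, ‖cwd [i, j] w₁ x - cwd [i, j] w₂ x‖) := by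
  have hM0 : 0 ≤ M := hS.M_nonneg
  have hL0 : 0 ≤ L := hS.L_nonneg
  have hd0 : (0 : ℝ) ≤ d := Nat.cast_nonneg d
  rw [cwd_singleton_gfield_eq hS hw₁ i x, cwd_singleton_gfield_eq hS hw₂ i x]
  -- abbreviations of the jet differences (plain variables, no `set`)
  obtain ⟨Δ₀, hΔ₀⟩ : ∃ z : ℝ, z = ‖w₁ x - w₂ x‖ := ⟨_, rfl⟩
  obtain ⟨Δ₁, hΔ₁⟩ : ∃ z : ℝ, z = ∑ j, ‖cwd [j] w₁ x - cwd [j] w₂ x‖ := ⟨_, rfl⟩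
  obtain ⟨Δ₂, hΔ₂⟩ : ∃ z : ℝ, z = ∑ j, ‖cwd [i, j] w₁ x - cwd [i, j] w₂ x‖ := ⟨_, rfl⟩
  rw [← hΔ₀, ← hΔ₁, ← hΔ₂]
  have hΔ₀0 : 0 ≤ Δ₀ := by rw [hΔ₀]; exact norm_nonneg _
  have hΔ₁0 : 0 ≤ Δ₁ := by rw [hΔ₁]; exact Finset.sum_nonneg fun j _ => norm_nonneg _
  have hΔ₂0 : 0 ≤ Δ₂ := by rw [hΔ₂]; exact Finset.sum_nonneg fun j _ => norm_nonneg _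
  have hri : ‖cwd [i] w₁ x - cwd [i] w₂ x‖ ≤ Δ₁ := by
    rw [hΔ₁]
    exact Finset.single_le_sum (f := fun j => ‖cwd [j] w₁ x - cwd [j] w₂ x‖) (fun _ _ => norm_nonneg _)
      (Finset.mem_univ i)
  have hw0 : ‖w₁ x - w₂ x‖ ≤ Δ₀ := hΔ₀ ▸ le_rfl
  have hrij : ∀ j, ‖cwd [i, j] w₁ x - cwd [i, j] w₂ x‖ ≤ Δ₂ := fun j => by
    rw [hΔ₂]
    exact Finset.single_le_sum (f := fun j => ‖cwd [i, j] w₁ x - cwd [i, j] w₂ x‖)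
      (fun _ _ => norm_nonneg _) (Finset.mem_univ j)
  -- term by term
  have hA : ∀ j : Fin d, ‖a j (w₁ x) (cwd [i, j] w₁ x) - a j (w₂ x) (cwd [i, j] w₂ x)‖ ≤
      M * ‖cwd [i, j] w₁ x - cwd [i, j] w₂ x‖ + M * R * Δ₀ := by
    intro j
    have e : a j (w₁ x) (cwd [i, j] w₁ x) - a j (w₂ x) (cwd [i, j] w₂ x) =
        a j (w₁ x) (cwd [i, j] w₁ x - cwd [i, j] w₂ x) + (a j (w₁ x) - a j (w₂ x)) (cwd [i, j] w₂ x) := by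
      rw [map_sub, sub_apply]; abel
    rw [e]
    refine (norm_add_le _ _).trans (add_le_add ?_ ?_)
    · exact (le_opNorm _ _).trans (mul_le_mul_of_nonneg_right (hS.norm_a j _) (norm_nonneg _))
    · calc ‖(a j (w₁ x) - a j (w₂ x)) (cwd [i, j] w₂ x)‖ ≤ ‖a j (w₁ x) - a j (w₂ x)‖ * ‖cwd [i, j] w₂ x‖ :=
            le_opNorm _ _
        _ ≤ (M * Δ₀) * R :=
            mul_le_mul ((hS.norm_a_sub_le j _ _).trans (mul_le_mul_of_nonneg_left hw0 hM0)) (h2₂ j)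
              (norm_nonneg _) (mul_nonneg hM0 hΔ₀0)
        _ = M * R * Δ₀ := by ring
  have hB : ∀ j : Fin d, ‖fderiv ℝ (a j) (w₁ x) (cwd [i] w₁ x) (cwd [j] w₁ x) -
      fderiv ℝ (a j) (w₂ x) (cwd [i] w₂ x) (cwd [j] w₂ x)‖ ≤
      Ka * R ^ 2 * Δ₀ + M * R * Δ₁ + M * R * ‖cwd [j] w₁ x - cwd [j] w₂ x‖ := by
    intro j
    have e : fderiv ℝ (a j) (w₁ x) (cwd [i] w₁ x) (cwd [j] w₁ x) -
        fderiv ℝ (a j) (w₂ x) (cwd [i] w₂ x) (cwd [j] w₂ x) =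
        (fderiv ℝ (a j) (w₁ x) - fderiv ℝ (a j) (w₂ x)) (cwd [i] w₁ x) (cwd [j] w₁ x) +
          fderiv ℝ (a j) (w₂ x) (cwd [i] w₁ x - cwd [i] w₂ x) (cwd [j] w₁ x) +
          fderiv ℝ (a j) (w₂ x) (cwd [i] w₂ x) (cwd [j] w₁ x - cwd [j] w₂ x) := by
      simp only [map_sub, sub_apply]; abel
    rw [e]
    refine (norm_add₃_le).trans (add_le_add (add_le_add ?_ ?_) ?_)
    · calc ‖(fderiv ℝ (a j) (w₁ x) - fderiv ℝ (a j) (w₂ x)) (cwd [i] w₁ x) (cwd [j] w₁ x)‖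
          ≤ ‖fderiv ℝ (a j) (w₁ x) - fderiv ℝ (a j) (w₂ x)‖ * ‖cwd [i] w₁ x‖ * ‖cwd [j] w₁ x‖ :=
            le_opNorm₂ _ _ _
        _ ≤ (Ka * Δ₀) * R * R :=
            mul_le_mul (mul_le_mul ((hKa' j _ _).trans (mul_le_mul_of_nonneg_left hw0 hKa)) (h1₁ i)
              (norm_nonneg _) (mul_nonneg hKa hΔ₀0)) (h1₁ j) (norm_nonneg _)
              (mul_nonneg (mul_nonneg hKa hΔ₀0) hR)
        _ = Ka * R ^ 2 * Δ₀ := by ring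
    · calc ‖fderiv ℝ (a j) (w₂ x) (cwd [i] w₁ x - cwd [i] w₂ x) (cwd [j] w₁ x)‖
          ≤ ‖fderiv ℝ (a j) (w₂ x)‖ * ‖cwd [i] w₁ x - cwd [i] w₂ x‖ * ‖cwd [j] w₁ x‖ := le_opNorm₂ _ _ _
        _ ≤ M * Δ₁ * R :=
            mul_le_mul (mul_le_mul (hS.norm_fderiv_a j _) hri (norm_nonneg _) hM0) (h1₁ j)
              (norm_nonneg _) (mul_nonneg hM0 hΔ₁0)
        _ = M * R * Δ₁ := by ring
    · calc ‖fderiv ℝ (a j) (w₂ x) (cwd [i] w₂ x) (cwd [j] w₁ x - cwd [j] w₂ x)‖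
          ≤ ‖fderiv ℝ (a j) (w₂ x)‖ * ‖cwd [i] w₂ x‖ * ‖cwd [j] w₁ x - cwd [j] w₂ x‖ := le_opNorm₂ _ _ _
        _ ≤ M * R * ‖cwd [j] w₁ x - cwd [j] w₂ x‖ :=
            mul_le_mul_of_nonneg_right (mul_le_mul (hS.norm_fderiv_a j _) (h1₂ i) (norm_nonneg _) hM0)
              (norm_nonneg _)
  have hC : ‖fderiv ℝ b (w₁ x) (cwd [i] w₁ x) - fderiv ℝ b (w₂ x) (cwd [i] w₂ x)‖ ≤ Kb * R * Δ₀ + L * Δ₁ := by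
    have e : fderiv ℝ b (w₁ x) (cwd [i] w₁ x) - fderiv ℝ b (w₂ x) (cwd [i] w₂ x) =
        (fderiv ℝ b (w₁ x) - fderiv ℝ b (w₂ x)) (cwd [i] w₁ x) + fderiv ℝ b (w₂ x) (cwd [i] w₁ x - cwd [i] w₂ x) := by
      rw [map_sub, sub_apply]; abel
    rw [e]
    refine (norm_add_le _ _).trans (add_le_add ?_ ?_)
    · calc ‖(fderiv ℝ b (w₁ x) - fderiv ℝ b (w₂ x)) (cwd [i] w₁ x)‖
          ≤ ‖fderiv ℝ b (w₁ x) - fderiv ℝ b (w₂ x)‖ * ‖cwd [i] w₁ x‖ := le_opNorm _ _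
        _ ≤ (Kb * Δ₀) * R :=
            mul_le_mul ((hKb' _ _).trans (mul_le_mul_of_nonneg_left hw0 hKb)) (h1₁ i) (norm_nonneg _)
              (mul_nonneg hKb hΔ₀0)
        _ = Kb * R * Δ₀ := by ring
    · exact (le_opNorm _ _).trans (mul_le_mul (hS.norm_fderiv_b _) hri (norm_nonneg _) hL0)
  -- summing
  have hj : ∀ j : Fin d, ‖a j (w₁ x) (cwd [i, j] w₁ x) + fderiv ℝ (a j) (w₁ x) (cwd [i] w₁ x) (cwd [j] w₁ x) -
      (a j (w₂ x) (cwd [i, j] w₂ x) + fderiv ℝ (a j) (w₂ x) (cwd [i] w₂ x) (cwd [j] w₂ x))‖ ≤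
      M * ‖cwd [i, j] w₁ x - cwd [i, j] w₂ x‖ + (M * R * Δ₀ + (Ka * R ^ 2 * Δ₀ + M * R * Δ₁ + M * R * Δ₁)) := by
    intro j
    have e : a j (w₁ x) (cwd [i, j] w₁ x) + fderiv ℝ (a j) (w₁ x) (cwd [i] w₁ x) (cwd [j] w₁ x) -
        (a j (w₂ x) (cwd [i, j] w₂ x) + fderiv ℝ (a j) (w₂ x) (cwd [i] w₂ x) (cwd [j] w₂ x)) =
        (a j (w₁ x) (cwd [i, j] w₁ x) - a j (w₂ x) (cwd [i, j] w₂ x)) +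
          (fderiv ℝ (a j) (w₁ x) (cwd [i] w₁ x) (cwd [j] w₁ x) -
            fderiv ℝ (a j) (w₂ x) (cwd [i] w₂ x) (cwd [j] w₂ x)) := by abel
    rw [e]
    have hBj : Ka * R ^ 2 * Δ₀ + M * R * Δ₁ + M * R * ‖cwd [j] w₁ x - cwd [j] w₂ x‖ ≤
        Ka * R ^ 2 * Δ₀ + M * R * Δ₁ + M * R * Δ₁ :=
      add_le_add le_rfl (mul_le_mul_of_nonneg_left ((Finset.single_le_sum
        (f := fun j => ‖cwd [j] w₁ x - cwd [j] w₂ x‖) (fun _ _ => norm_nonneg _)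
        (Finset.mem_univ j)).trans_eq hΔ₁.symm) (mul_nonneg hM0 hR))
    calc _ ≤ (M * ‖cwd [i, j] w₁ x - cwd [i, j] w₂ x‖ + M * R * Δ₀) +
          (Ka * R ^ 2 * Δ₀ + M * R * Δ₁ + M * R * Δ₁) :=
          (norm_add_le _ _).trans (add_le_add (hA j) ((hB j).trans hBj))
      _ = _ := by ring
  have hsum : ‖(∑ j, (a j (w₁ x) (cwd [i, j] w₁ x) + fderiv ℝ (a j) (w₁ x) (cwd [i] w₁ x) (cwd [j] w₁ x))) -
      ∑ j, (a j (w₂ x) (cwd [i, j] w₂ x) + fderiv ℝ (a j) (w₂ x) (cwd [i] w₂ x) (cwd [j] w₂ x))‖ ≤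
      M * Δ₂ + d * (M * R * Δ₀ + (Ka * R ^ 2 * Δ₀ + M * R * Δ₁ + M * R * Δ₁)) := by
    rw [← Finset.sum_sub_distrib]
    refine (norm_sum_le _ _).trans ((Finset.sum_le_sum fun j _ => hj j).trans (le_of_eq ?_))
    rw [Finset.sum_add_distrib, ← Finset.mul_sum, ← hΔ₂, Finset.sum_const, Finset.card_univ,
      Fintype.card_fin, nsmul_eq_mul]
  have htot : ‖(∑ j, (a j (w₁ x) (cwd [i, j] w₁ x) + fderiv ℝ (a j) (w₁ x) (cwd [i] w₁ x) (cwd [j] w₁ x))) +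
        fderiv ℝ b (w₁ x) (cwd [i] w₁ x) -
        ((∑ j, (a j (w₂ x) (cwd [i, j] w₂ x) + fderiv ℝ (a j) (w₂ x) (cwd [i] w₂ x) (cwd [j] w₂ x))) +
          fderiv ℝ b (w₂ x) (cwd [i] w₂ x))‖ ≤
      M * Δ₂ + d * (M * R * Δ₀ + (Ka * R ^ 2 * Δ₀ + M * R * Δ₁ + M * R * Δ₁)) + (Kb * R * Δ₀ + L * Δ₁) := by
    have e : (∑ j, (a j (w₁ x) (cwd [i, j] w₁ x) + fderiv ℝ (a j) (w₁ x) (cwd [i] w₁ x) (cwd [j] w₁ x))) +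
        fderiv ℝ b (w₁ x) (cwd [i] w₁ x) -
        ((∑ j, (a j (w₂ x) (cwd [i, j] w₂ x) + fderiv ℝ (a j) (w₂ x) (cwd [i] w₂ x) (cwd [j] w₂ x))) +
          fderiv ℝ b (w₂ x) (cwd [i] w₂ x)) =
        ((∑ j, (a j (w₁ x) (cwd [i, j] w₁ x) + fderiv ℝ (a j) (w₁ x) (cwd [i] w₁ x) (cwd [j] w₁ x))) -
          ∑ j, (a j (w₂ x) (cwd [i, j] w₂ x) + fderiv ℝ (a j) (w₂ x) (cwd [i] w₂ x) (cwd [j] w₂ x))) +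
          (fderiv ℝ b (w₁ x) (cwd [i] w₁ x) - fderiv ℝ b (w₂ x) (cwd [i] w₂ x)) := by abel
    rw [e]
    exact (norm_add_le _ _).trans (add_le_add hsum hC)
  refine htot.trans ?_
  -- the final (linear in the monomials) comparison
  have hdMR : 0 ≤ (d : ℝ) * (M * R) := mul_nonneg hd0 (mul_nonneg hM0 hR)
  have hMR : 0 ≤ M * R := mul_nonneg hM0 hR
  have hdKaR : 0 ≤ (d : ℝ) * (Ka * R ^ 2) := mul_nonneg hd0 (mul_nonneg hKa (sq_nonneg R))
  have hKbR : 0 ≤ Kb * R := mul_nonneg hKb hR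
  have hx0 : ((d : ℝ) * (M * R) + d * (Ka * R ^ 2) + Kb * R) * Δ₀ ≤
      (d * (M * R + Ka * R ^ 2) + Kb * R + (d * M * R + L) + M * R + M) * Δ₀ :=
    mul_le_mul_of_nonneg_right (by linarith) hΔ₀0
  have hx1 : (2 * ((d : ℝ) * (M * R)) + L) * Δ₁ ≤
      (d * (M * R + Ka * R ^ 2) + Kb * R + (d * M * R + L) + M * R + M) * Δ₁ :=
    mul_le_mul_of_nonneg_right (by linarith) hΔ₁0
  have hx2 : M * Δ₂ ≤ (d * (M * R + Ka * R ^ 2) + Kb * R + (d * M * R + L) + M * R + M) * Δ₂ :=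
    mul_le_mul_of_nonneg_right (by linarith) hΔ₂0
  linarith [hx0, hx1, hx2]

/-! ### Derivatives pass through the double mollification -/

/-- `∂_c(ρ_δ ⋆ (ρ_δ ⋆ g)) = ρ_δ ⋆ (ρ_δ ⋆ ∂_c g)` for smooth `g`. [cite: Evans2010, App. C.4 Thm. 7] -/
theorem cwd_moll_moll_eq {F : Type*} [NormedAddCommGroup F] [NormedSpace ℝ F] [CompleteSpace F]
    {δ : ℝ} (hδ : 0 < δ) {g : EuclideanSpace ℝ (Fin d) → F} (hg : ContDiff ℝ ∞ g) (c : List (Fin d)) :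
    cwd c (moll (Fin d) hδ ⋆[lsmul ℝ ℝ, volume] (moll (Fin d) hδ ⋆[lsmul ℝ ℝ, volume] g)) =
      moll (Fin d) hδ ⋆[lsmul ℝ ℝ, volume] (moll (Fin d) hδ ⋆[lsmul ℝ ℝ, volume] cwd c g) := by
  have hρg : ContDiff ℝ ∞ (moll (Fin d) hδ ⋆[lsmul ℝ ℝ, volume] g) :=
    contDiff_convolution_kernel (contDiff_moll hδ) (hasCompactSupport_moll hδ) hg.continuous.locallyIntegrable
  rw [cwd_convolution_eq_convolution_cwd (continuous_moll hδ) (hasCompactSupport_moll hδ) hρg,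
    cwd_convolution_eq_convolution_cwd (continuous_moll hδ) (hasCompactSupport_moll hδ) hg]

/-! ### Sup-Cauchy smallness of `∂ᵢ∂ₜW_δ` -/

section Family

variable (hS : IsSymmSmoothCoeff M L a b s) {m : ℕ} (hm : 4 * (d + 1) ≤ m)

/-- **Sup-Cauchy smallness of `∂ᵢ(ρ_δ⋆ρ_δ⋆G(W_δ(t)))`** (the spatial derivative of `-∂ₜW_δ`): for
every `ε > 0` there are `η > 0` and `θ > 0` (coefficients, `d`, `k`, `m` only) such that under the
smallness condition `eConst e^{eRate T} ℰ_m(u₀) < 1`, for `δ, δ' ∈ (0, 1]` with `δ + δ' ≤ θ`,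
`|t| ≤ T` and `L²`-Cauchy quantity `≤ η`:
`‖∂ᵢ(ρ_δ⋆ρ_δ⋆G(W_δ(t)))(x) - ∂ᵢ(ρ_{δ'}⋆ρ_{δ'}⋆G(W_{δ'}(t)))(x)‖ ≤ ε` (derivatives pass onto
`G`, mollification rate `norm_moll_moll_sub_self_le` twice with the sup bound of `∂²G(W_δ)`, and
the 2-jet Lipschitz bound `norm_cwd_singleton_gfield_sub_le` with `exists_sup_small_Wfam`).
[cite: TaylorPDEIII2011, Ch. 16 §1, (1.21)–(1.22)] -/
theorem exists_sup_small_dxdtWfam (hm1 : 4 * (d + 1) + 1 ≤ m) {ε : ℝ} (hε : 0 < ε) :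
    ∃ η θ : ℝ, 0 < η ∧ 0 < θ ∧ ∀ {u₀ : EuclideanSpace ℝ (Fin d) → EuclideanSpace ℝ (Fin k)}
      (hu₀ : ContDiff ℝ ∞ u₀) (hu₀c : HasCompactSupport u₀) {T : ℝ}, 0 ≤ T →
      eConst hS hm * Real.exp (eRate hS hm * T) * wordEnergy m u₀ < 1 →
      ∀ {δ δ' : ℝ} (hδ : 0 < δ), δ ≤ 1 → ∀ (hδ' : 0 < δ'), δ' ≤ 1 → δ + δ' ≤ θ → ∀ t ∈ Icc (-T) T,
        cConst hS hm * Real.exp (cRate hS hm * T) * (δ + δ') * (1 + ∑ j, l2norm (cwd [j] u₀)) ≤ η →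
        ∀ (i : Fin d) (x : EuclideanSpace ℝ (Fin d)),
          ‖cwd [i] (moll (Fin d) hδ ⋆[lsmul ℝ ℝ, volume] (moll (Fin d) hδ ⋆[lsmul ℝ ℝ, volume]
              gfield a b (Wfam hS.toIsTameCoeff hu₀ hu₀c δ t))) x -
            cwd [i] (moll (Fin d) hδ' ⋆[lsmul ℝ ℝ, volume] (moll (Fin d) hδ' ⋆[lsmul ℝ ℝ, volume]
              gfield a b (Wfam hS.toIsTameCoeff hu₀ hu₀c δ' t))) x‖ ≤ ε := by
  -- constants for the sup bound of `∂²G(W_δ)`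
  set R₀ : ℝ := Real.sqrt (supConst (Fin d) (EuclideanSpace ℝ (Fin k))) with hR₀
  have hR₀0 : 0 ≤ R₀ := Real.sqrt_nonneg _
  have hSa0 := fun j : Fin d => exists_sup_bound_cwd_comp_whole (ι := Fin d) 2 (hS.smooth_a j) (hS.bdd_a j) R₀
  choose Ca' hCa'0 hCa' using hSa0
  obtain ⟨Cb', hCb'0, hCb'⟩ := exists_sup_bound_cwd_comp_whole (ι := Fin d) 2 hS.smooth_b hS.bdd_b R₀
  set CA' : ℝ := ∑ j, Ca' j with hCA'
  have hCA'0 : 0 ≤ CA' := Finset.sum_nonneg fun j _ => hCa'0 j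
  have hleA' : ∀ j, Ca' j ≤ CA' := fun j =>
    Finset.single_le_sum (f := Ca') (fun i _ => hCa'0 i) (Finset.mem_univ j)
  have hM0 : 0 ≤ M := hS.M_nonneg
  have hL0 : 0 ≤ L := hS.L_nonneg
  have hd0 : (0 : ℝ) ≤ d := Nat.cast_nonneg d
  -- Lipschitz constants of `Daⱼ` and `Db`
  have hKa1 := fun j : Fin d => exists_norm_fderiv_sub_le_of_bdd (hS.smooth_a j) (hS.bdd_a j)
  choose Ka hKa0 hKa using hKa1
  obtain ⟨Kb, hKb0, hKb⟩ := exists_norm_fderiv_sub_le_of_bdd hS.smooth_b hS.bdd_b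
  set KA : ℝ := ∑ j, Ka j with hKA
  have hKA0 : 0 ≤ KA := Finset.sum_nonneg fun j _ => hKa0 j
  have hleKA : ∀ j, Ka j ≤ KA := fun j =>
    Finset.single_le_sum (f := Ka) (fun i _ => hKa0 i) (Finset.mem_univ j)
  have hKa' : ∀ j p p', ‖fderiv ℝ (a j) p - fderiv ℝ (a j) p'‖ ≤ KA * ‖p - p'‖ := fun j p p' =>
    (hKa j p p').trans (mul_le_mul_of_nonneg_right (hleKA j) (norm_nonneg _))
  -- `K_G` bounds `‖∂_c G(W_δ(t))‖`, `|c| ≤ 2`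
  obtain ⟨KG, hKG⟩ : ∃ x : ℝ, x = d * 2 ^ 2 * (CA' * R₀) + Cb' := ⟨_, rfl⟩
  have hKG0 : 0 ≤ KG := by rw [hKG]; positivity
  -- the Lipschitz constant of `∂ᵢG` in the sup norms of orders `0, 1, 2`
  obtain ⟨CL, hCL⟩ : ∃ x : ℝ, x =
      d * (M * R₀ + KA * R₀ ^ 2) + Kb * R₀ + (d * M * R₀ + L) + M * R₀ + M := ⟨_, rfl⟩
  have hCL0 : 0 ≤ CL := by rw [hCL]; positivity
  obtain ⟨LG, hLG⟩ : ∃ x : ℝ, x = CL * (1 + 2 * d) := ⟨_, rfl⟩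
  have hLG0 : 0 ≤ LG := by rw [hLG]; positivity
  -- smallness of `W_δ - W_{δ'}` up to order `2`, at level `ε₁`
  set ε₁ : ℝ := ε / (3 * (LG + 1)) with hε₁
  have hε₁0 : 0 < ε₁ := by positivity
  obtain ⟨η, hη0, hη⟩ := exists_sup_small_Wfam hS hm hm1 hε₁0
  set θ : ℝ := ε / (3 * (2 * d * KG + 1)) with hθ
  have hθ0 : 0 < θ := by positivity
  refine ⟨η, θ, hη0, hθ0, ?_⟩
  intro u₀ hu₀ hu₀c T hT hsm δ δ' hδ hδ1 hδ' hδ'1 hδθ t ht hsmall i x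
  have h3 : 3 + 2 * (d + 1) ≤ m := by omega
  set W₁ := Wfam hS.toIsTameCoeff hu₀ hu₀c δ t with hW₁
  set W₂ := Wfam hS.toIsTameCoeff hu₀ hu₀c δ' t with hW₂
  set G₁ := gfield a b W₁ with hG₁
  set G₂ := gfield a b W₂ with hG₂
  have hW₁s : ContDiff ℝ ∞ W₁ := contDiff_Wfam hS.toIsTameCoeff hu₀ hu₀c hδ t
  have hW₂s : ContDiff ℝ ∞ W₂ := contDiff_Wfam hS.toIsTameCoeff hu₀ hu₀c hδ' t
  have hG₁s : ContDiff ℝ ∞ G₁ := contDiff_gfield hS hW₁s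
  have hG₂s : ContDiff ℝ ∞ G₂ := contDiff_gfield hS hW₂s
  -- sup control up to order `3` of both fields
  have hsup₁ : ∀ c' : List (Fin d), c'.length ≤ 2 + 1 → ∀ y, ‖cwd c' W₁ y‖ ≤ R₀ := fun c' hc' y =>
    (norm_cwd_Wfam_le_Rdat hS hm hu₀ hu₀c hT hsm hδ hδ1 ht c' (by omega) y).trans
      (Rdat_le_sqrt_supConst hS hm hsm)
  have hsup₂ : ∀ c' : List (Fin d), c'.length ≤ 2 + 1 → ∀ y, ‖cwd c' W₂ y‖ ≤ R₀ := fun c' hc' y =>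
    (norm_cwd_Wfam_le_Rdat hS hm hu₀ hu₀c hT hsm hδ' hδ'1 ht c' (by omega) y).trans
      (Rdat_le_sqrt_supConst hS hm hsm)
  -- `‖∂_c G‖ ≤ K_G` for `|c| ≤ 2`
  have hKG₁ : ∀ c' : List (Fin d), c'.length ≤ 2 → ∀ y, ‖cwd c' G₁ y‖ ≤ KG := fun c' hc' y => by
    rw [hKG]
    exact norm_cwd_gfield_le_of_sup hS hW₁s hR₀0 hCA'0 hsup₁
      (fun j v hv z => (hCa' j _ hW₁s (fun c' _ hc' w => hsup₁ c' (by omega) w) v hv z).trans (hleA' j))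
      (fun v hv z => hCb' _ hW₁s (fun c' _ hc' w => hsup₁ c' (by omega) w) v hv z) c' hc' y
  have hKG₂ : ∀ c' : List (Fin d), c'.length ≤ 2 → ∀ y, ‖cwd c' G₂ y‖ ≤ KG := fun c' hc' y => by
    rw [hKG]
    exact norm_cwd_gfield_le_of_sup hS hW₂s hR₀0 hCA'0 hsup₂
      (fun j v hv z => (hCa' j _ hW₂s (fun c' _ hc' w => hsup₂ c' (by omega) w) v hv z).trans (hleA' j))
      (fun v hv z => hCb' _ hW₂s (fun c' _ hc' w => hsup₂ c' (by omega) w) v hv z) c' hc' y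
  -- derivatives pass through the mollifiers
  rw [cwd_moll_moll_eq hδ hG₁s [i], cwd_moll_moll_eq hδ' hG₂s [i]]
  -- the three pieces
  have hp1 : ‖(moll (Fin d) hδ ⋆[lsmul ℝ ℝ, volume] (moll (Fin d) hδ ⋆[lsmul ℝ ℝ, volume] cwd [i] G₁)) x -
      cwd [i] G₁ x‖ ≤ 2 * δ * (d * KG) := by
    have h := norm_moll_moll_sub_self_le hδ (contDiff_cwd hG₁s [i]) (K := fun _ => KG)
      (fun l y => by rw [← cwd_append]; exact hKG₁ ([l] ++ [i]) (by simp) y) x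
    simpa [Finset.sum_const, Finset.card_univ, Fintype.card_fin] using h
  have hp3 : ‖(moll (Fin d) hδ' ⋆[lsmul ℝ ℝ, volume] (moll (Fin d) hδ' ⋆[lsmul ℝ ℝ, volume] cwd [i] G₂)) x -
      cwd [i] G₂ x‖ ≤ 2 * δ' * (d * KG) := by
    have h := norm_moll_moll_sub_self_le hδ' (contDiff_cwd hG₂s [i]) (K := fun _ => KG)
      (fun l y => by rw [← cwd_append]; exact hKG₂ ([l] ++ [i]) (by simp) y) x
    simpa [Finset.sum_const, Finset.card_univ, Fintype.card_fin] using h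
  have hsmallW : ∀ c' : List (Fin d), c'.length ≤ 2 → ∀ y, ‖cwd c' W₁ y - cwd c' W₂ y‖ ≤ ε₁ :=
    fun c' hc' y => hη hu₀ hu₀c hT hsm hδ hδ1 hδ' hδ'1 t ht hsmall c' hc' y
  have hp2 : ‖cwd [i] G₁ x - cwd [i] G₂ x‖ ≤ LG * ε₁ := by
    refine (norm_cwd_singleton_gfield_sub_le hS hW₁s hW₂s hR₀0 hKA0 hKb0 hKa' hKb i x
      (fun j => hsup₁ [j] (by simp) x) (fun j => hsup₂ [j] (by simp) x)
      (fun j => hsup₂ [i, j] (by simp) x)).trans ?_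
    rw [← hCL]
    have h0 : ‖W₁ x - W₂ x‖ ≤ ε₁ := by simpa using hsmallW [] (by simp) x
    have h1 : ∑ j, ‖cwd [j] W₁ x - cwd [j] W₂ x‖ ≤ d * ε₁ := by
      calc ∑ j, ‖cwd [j] W₁ x - cwd [j] W₂ x‖ ≤ ∑ _j : Fin d, ε₁ :=
            Finset.sum_le_sum fun j _ => hsmallW [j] (by simp) x
        _ = d * ε₁ := by simp
    have h2 : ∑ j, ‖cwd [i, j] W₁ x - cwd [i, j] W₂ x‖ ≤ d * ε₁ := by
      calc ∑ j, ‖cwd [i, j] W₁ x - cwd [i, j] W₂ x‖ ≤ ∑ _j : Fin d, ε₁ :=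
            Finset.sum_le_sum fun j _ => hsmallW [i, j] (by simp) x
        _ = d * ε₁ := by simp
    calc CL * (‖W₁ x - W₂ x‖ + ∑ j, ‖cwd [j] W₁ x - cwd [j] W₂ x‖ + ∑ j, ‖cwd [i, j] W₁ x - cwd [i, j] W₂ x‖)
        ≤ CL * (ε₁ + d * ε₁ + d * ε₁) := mul_le_mul_of_nonneg_left (add_le_add (add_le_add h0 h1) h2) hCL0
      _ = LG * ε₁ := by rw [hLG]; ring
  -- assembling
  have hsplit : (moll (Fin d) hδ ⋆[lsmul ℝ ℝ, volume] (moll (Fin d) hδ ⋆[lsmul ℝ ℝ, volume] cwd [i] G₁)) x -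
      (moll (Fin d) hδ' ⋆[lsmul ℝ ℝ, volume] (moll (Fin d) hδ' ⋆[lsmul ℝ ℝ, volume] cwd [i] G₂)) x =
      ((moll (Fin d) hδ ⋆[lsmul ℝ ℝ, volume] (moll (Fin d) hδ ⋆[lsmul ℝ ℝ, volume] cwd [i] G₁)) x -
          cwd [i] G₁ x) + (cwd [i] G₁ x - cwd [i] G₂ x) -
        ((moll (Fin d) hδ' ⋆[lsmul ℝ ℝ, volume] (moll (Fin d) hδ' ⋆[lsmul ℝ ℝ, volume] cwd [i] G₂)) x -
          cwd [i] G₂ x) := by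
    abel
  rw [hsplit]
  have hδsum : 2 * δ * (d * KG) + 2 * δ' * (d * KG) ≤ ε / 3 := by
    have h1 : 2 * δ * (d * KG) + 2 * δ' * (d * KG) = (δ + δ') * (2 * d * KG) := by ring
    rw [h1]
    calc (δ + δ') * (2 * d * KG) ≤ θ * (2 * d * KG) := mul_le_mul_of_nonneg_right hδθ (by positivity)
      _ ≤ ε / 3 := by
          rw [hθ, div_mul_eq_mul_div, div_le_iff₀ (by positivity)]
          have e3 : ε / 3 * (3 * (2 * d * KG + 1)) = ε * (2 * d * KG) + ε := by ring
          rw [e3]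
          exact le_add_of_nonneg_right hε.le
  have hmid : LG * ε₁ ≤ ε / 3 := by
    rw [hε₁, mul_div_assoc', div_le_iff₀ (by positivity)]
    have e3 : ε / 3 * (3 * (LG + 1)) = LG * ε + ε := by ring
    rw [e3]
    exact le_add_of_nonneg_right hε.le
  calc ‖((moll (Fin d) hδ ⋆[lsmul ℝ ℝ, volume] (moll (Fin d) hδ ⋆[lsmul ℝ ℝ, volume] cwd [i] G₁)) x -
          cwd [i] G₁ x) + (cwd [i] G₁ x - cwd [i] G₂ x) -
        ((moll (Fin d) hδ' ⋆[lsmul ℝ ℝ, volume] (moll (Fin d) hδ' ⋆[lsmul ℝ ℝ, volume] cwd [i] G₂)) x -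
          cwd [i] G₂ x)‖
      ≤ ‖(moll (Fin d) hδ ⋆[lsmul ℝ ℝ, volume] (moll (Fin d) hδ ⋆[lsmul ℝ ℝ, volume] cwd [i] G₁)) x -
            cwd [i] G₁ x‖ + ‖cwd [i] G₁ x - cwd [i] G₂ x‖ +
          ‖(moll (Fin d) hδ' ⋆[lsmul ℝ ℝ, volume] (moll (Fin d) hδ' ⋆[lsmul ℝ ℝ, volume] cwd [i] G₂)) x -
            cwd [i] G₂ x‖ :=
        (norm_sub_le _ _).trans (add_le_add (norm_add_le _ _) le_rfl)
    _ ≤ 2 * δ * (d * KG) + LG * ε₁ + 2 * δ' * (d * KG) := add_le_add (add_le_add hp1 hp2) hp3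
    _ ≤ ε := by linarith

end Family

end Literature.Barriers.AtomisticToContinuum

end
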